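import Mathlib
import Summits.Langlands.Langlands.Theses.TorsionKudlaMillsonWindow
import Literature.NumberTheory.Automorphic.QuaternionCoordOrder

/-!
# Crux `FTraceCongruenceGeneration` (stmt-Langlands-13533) — line `coset-twist` (strategist skeleton)

The F-TRACE TWO-FACTOR MECHANISM (refuter evidence EVIDENCE.md §6 on the item, typed here): a norm-one
unit `γ` of the coordinate order `O = 𝓞_K⟨1,i,j,k⟩` is written `γ = (γu)u⁻¹` with `u ∈ O₀¹` (coordinates
in `F`) chosen so that `γu` has reduced trace in `F`; this is a representation problem for the indefinite
ternary `𝓞_F`-lattice `gO₀ ∩ B₀⁰`, `g` the `σ`-odd part of `γ`.  Three registered stubs, each a genuine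
piece (they are the route items `CosetFTraceTwist`, `TorsionTraceFinite`, `CongruenceCosetCapture` of
`Theses/TorsionKudlaMillsonWindow.lean`; each stub concludes its route item BY NAME):

* `stub_cosetFTraceTwist` — on one congruence coset `xΓ¹(M)`, off finitely many square classes `C`,
  the twist `u` exists with `re u`, `re (γu)` outside any prescribed finite `T` (genus / spinor genus of
  ternary lattices + Zariski density);
* `stub_torsionTraceFinite` — real parts of finite-order elements of `Γ¹` form a finite set;
* `stub_congruenceCosetCapture` — `Γ¹(M') ⊆ Good⁻¹ · Good` (non-thinness of congruence cosets: strong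
  approximation mod `𝔭` + a finite-field count).

`FTraceCongruenceGeneration_of` is the kernel-checked composition (no `sorry`): `T` from the torsion
stub feeds the twist stub, whose `(C, M, x)` feed the capture stub; for `γ ∈ Γ¹(M')`,
`γ = t₁⁻¹t₂ = u₁ (t₁u₁)⁻¹ (t₂u₂) u₂⁻¹` with all four factors F-trace loxodromics.
-/

set_option linter.dupNamespace false

namespace Summit.Langlands.Langlands.Cruxes.FTraceCongruenceGeneration.CosetTwist

open Summit.Langlands.Langlands.Theses.TorsionKudlaMillsonWindow
open scoped Quaternion
open NumberField Literature.NumberTheory.Automorphic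

/-! ## Registered stubs — the three pieces are ROUTE ITEMS, so each stub concludes its item BY NAME
(`@[route_item]` decls of `Theses/TorsionKudlaMillsonWindow.lean`; landing a stub = closing the item):
`CosetFTraceTwist` = stmt-Langlands-18921 (crux r2), `TorsionTraceFinite` = stmt-Langlands-18922 (support),
`CongruenceCosetCapture` = stmt-Langlands-18923 (crux r3). -/

/-- STUB (hardest, crux-grade) = route item `CosetFTraceTwist` (stmt-Langlands-18921): the coset twist —
representation of `nrd g` by the indefinite ternary lattices `gO₀ ∩ B₀⁰` uniformly on a congruence coset, off
finitely many square classes `C ⊇ {1, D}`, with trace avoidance by Zariski density. [folklore] -/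
theorem stub_cosetFTraceTwist : CosetFTraceTwist := by
  sorry

/-- STUB (support-grade) = route item `TorsionTraceFinite` (stmt-Langlands-18922): `re u` for `u ∈ Γ¹` of
finite order lies in a finite set (`φ(n) ≤ 2[K:ℚ]`). [folklore] -/
theorem stub_torsionTraceFinite : TorsionTraceFinite := by
  sorry

/-- STUB (crux-grade) = route item `CongruenceCosetCapture` (stmt-Langlands-18923): `Γ¹(M') ⊆ Good⁻¹·Good`
for every `M, x, C` (strong approximation for `B¹` modulo a prime where every `c ∈ C` is a square and
`nrd(t − σ_B t)` is a non-square unit). [folklore] -/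
theorem stub_congruenceCosetCapture : CongruenceCosetCapture := by
  sorry

/-- **Composition** (kernel-checked, no `sorry` of its own): the three stub statements — the route items
`CosetFTraceTwist`, `TorsionTraceFinite`, `CongruenceCosetCapture`, BY NAME — imply the crux
`FTraceCongruenceGeneration` BY NAME.  `T` from the torsion piece feeds the twist piece, whose `(C, M, x)` feed
the capture piece; for `γ ∈ Γ¹(M')`, `γ = t₁⁻¹t₂ = u₁ (t₁u₁)⁻¹ (t₂u₂) u₂⁻¹` with all four factors F-trace
loxodromics (closure of `O¹` under products from `Literature…QuaternionAlgebra.normOneGroup`, whose membership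
predicate is the route's inline `IsG u ∧ u ū = 1` by `Iff.rfl`).  Identical to the candidate Theorems proof
attached as evidence on stmt-Langlands-18924 (`FTraceCongruenceGenerationOfPieces`). [folklore] -/
theorem FTraceCongruenceGeneration_of :
    CosetFTraceTwist → TorsionTraceFinite → CongruenceCosetCapture → FTraceCongruenceGeneration := by

  intro hX1 hX2 hX3 F K _ _ _ _ _ σ a b hF hK2 hσ hcx ha hb hneg hpos a' b' hdiv IsInt IsG Cong FTr
  -- the three pieces, specialised to the present data
  obtain ⟨T, hT⟩ := hX2 F K σ a b hF hK2 hσ hcx ha hb hneg hpos hdiv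
  obtain ⟨C, M, x, hM, hx, hdec⟩ := hX1 F K σ a b hF hK2 hσ hcx ha hb hneg hpos hdiv T
  obtain ⟨M', hM', hcap⟩ := hX3 F K σ a b hF hK2 hσ hcx ha hb hneg hpos hdiv M x C hM hx
  refine ⟨M', hM', fun γ hγ hγ1 => ?_⟩
  obtain ⟨t₁, t₂, ht₁, ht₂, rfl⟩ := hcap γ hγ hγ1
  -- the coordinate order `O = 𝓞_K⟨1,i,j,k⟩` of the tree: `IsG u ↔ u ∈ O^×` definitionally
  set A : 𝓞 K := algebraMap (𝓞 F) (𝓞 K) a with hA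
  set Bb : 𝓞 K := algebraMap (𝓞 F) (𝓞 K) b with hBb
  have hG1 : ∀ u : (ℍ[K, a', b'])ˣ, (IsG u ∧ (u : ℍ[K, a', b']) * star (u : ℍ[K, a', b']) = 1) ↔
      u ∈ QuaternionAlgebra.normOneGroup (R := 𝓞 K) K A Bb := fun u => Iff.rfl
  -- closure bookkeeping
  set S : Set (ℍ[K, a', b'])ˣ := {u | FTr u} ∪ {w | ∃ u v, IsG u ∧ IsG v ∧ w = u * v * u⁻¹ * v⁻¹}
    with hS
  have memS : ∀ u : (ℍ[K, a', b'])ˣ, IsG u → (u : ℍ[K, a', b']) * star (u : ℍ[K, a', b']) = 1 →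
      σ (u : ℍ[K, a', b']).re = (u : ℍ[K, a', b']).re → (u : ℍ[K, a', b']).re ∉ T →
      u ∈ Subgroup.closure S := by
    intro u hu hu1 hre hT'
    refine Subgroup.subset_closure (Set.mem_union_left _ ?_)
    exact ⟨hu, hu1, hre, fun hfin => hT' (hT u hu hu1 hfin)⟩
  -- twist one factor: `t = (t u) u⁻¹` with both `u` and `t u` F-trace loxodromics
  have twist : ∀ t u : (ℍ[K, a', b'])ˣ,
      (IsG t ∧ (t : ℍ[K, a', b']) * star (t : ℍ[K, a', b']) = 1) →
      (IsG u ∧ (u : ℍ[K, a', b']) * star (u : ℍ[K, a', b']) = 1) →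
      (∀ i : Fin 4, σ (QuaternionAlgebra.equivTuple a' 0 b' (u : ℍ[K, a', b']) i) =
        QuaternionAlgebra.equivTuple a' 0 b' (u : ℍ[K, a', b']) i) →
      σ ((t * u : (ℍ[K, a', b'])ˣ) : ℍ[K, a', b']).re = ((t * u : (ℍ[K, a', b'])ˣ) : ℍ[K, a', b']).re →
      (u : ℍ[K, a', b']).re ∉ T → ((t * u : (ℍ[K, a', b'])ˣ) : ℍ[K, a', b']).re ∉ T →
      t ∈ Subgroup.closure S := by
    intro t u ht1 hu hcoord htr huT htuT
    have htu : IsG (t * u) ∧ ((t * u : (ℍ[K, a', b'])ˣ) : ℍ[K, a', b']) *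
        star ((t * u : (ℍ[K, a', b'])ˣ) : ℍ[K, a', b']) = 1 :=
      (hG1 (t * u)).mpr (Subgroup.mul_mem _ ((hG1 t).mp ht1) ((hG1 u).mp hu))
    have hure : σ (u : ℍ[K, a', b']).re = (u : ℍ[K, a', b']).re := by
      simpa [QuaternionAlgebra.equivTuple_apply] using hcoord 0
    have hu_mem : u ∈ Subgroup.closure S := memS u hu.1 hu.2 hure huT
    have htu_mem : t * u ∈ Subgroup.closure S := memS (t * u) htu.1 htu.2 htr htuT
    have : t = (t * u) * u⁻¹ := by group
    rw [this]
    exact Subgroup.mul_mem _ htu_mem (Subgroup.inv_mem _ hu_mem)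
  obtain ⟨u₁, hu₁, hco₁, htr₁, hu₁T, htu₁T⟩ := hdec t₁ ht₁
  obtain ⟨u₂, hu₂, hco₂, htr₂, hu₂T, htu₂T⟩ := hdec t₂ ht₂
  obtain ⟨ht₁1, -, -⟩ := ht₁
  obtain ⟨ht₂1, -, -⟩ := ht₂
  exact Subgroup.mul_mem _ (Subgroup.inv_mem _ (twist t₁ u₁ ht₁1 hu₁ hco₁ htr₁ hu₁T htu₁T))
    (twist t₂ u₂ ht₂1 hu₂ hco₂ htr₂ hu₂T htu₂T)

/-- WIRING CHECK: the three sorried stubs compose to a closed term of the crux's type (modulo their `sorry`s).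
An `example`, so that no pre-composed constant of type `FTraceCongruenceGeneration` enters any environment that
imports this workfile (BC3 probes stay honest). -/
example : FTraceCongruenceGeneration :=
  FTraceCongruenceGeneration_of stub_cosetFTraceTwist stub_torsionTraceFinite stub_congruenceCosetCapture

end Summit.Langlands.Langlands.Cruxes.FTraceCongruenceGeneration.CosetTwist
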